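/-
Origin: expansion seat `planner-pub-hodgecm-mc-axioms-1-g15-0`, handover #3 2026-08-20T20:59Z md5 889214948dea (NEW; 121 l.; imports `HodgeCM.Model.LiuDictionary` only; ns `HodgeCM.Model`; KERNEL theorems `subset_span_of_liuDictionary_le (T) (hirr h413 h4182 hμ h418) {K Ψ σ} (S hΦ hcorner) (Θ) (hIso : ∃ Γ₁ : Level V, ∀ Γ ≤ Γ₁, ∀ ω ∈ Θ Γ, ∃ x : T.H, x ∈ fixedBy Γ.K T.H ∧ T.res Γ x = ω ∧ x ∈ ⨆ μ ∈ S, T.block μ) : ∃ Γ₀, ∀ Γ ≤ Γ₀, Θ Γ ⊆ span ℂ (⋃ D : CommonReflexInput K Ψ σ, D.surfaceClasses hHD hI h₁ h₃ V Γ)` (the landed junction run on the family emptied above `Γ₁`, threshold `Γ₀ ⊓ Γ₁`), `hThetaUnion_of_liuDictionary_le` and `hsmall_of_liuDictionary_le (hR)` = the E-shaped corollaries of `Model/LiuDictionary` with the last clause of `hJ` weakened to `∃ Γ₁ : Level V, ∀ Γ ≤ Γ₁, ∀ ω ∈ R.Theta V c i Γ, ∃ x, …` — conclusions VERBATIM those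 of `hThetaUnion_of_liuDictionary` (= `hΘ` of `hsmall_of_commonReflexUnion_of … P`) ∕ `hsmall_of_liuDictionary`; WHY: the constructed `res Γ` of any tower instance (binder-1 #R111 `resTotal`) is the identity-component restriction only below the conjugates of `K_f(3)` and `0` elsewhere, so `hJ`'s all-level clause of the RUN-62 corollaries is not dischargeable at the instance while the `∃ Γ₁` clause is (`Γ₁ := Level.three V`). CERT lean-direct (1 process, nice 19, elan 4.32.0, `-DautoImplicit=false`) on the RUN-62 PKG oleans of record: rc 0 ∕ 5.5 s ∕ 0 warn ∕ 0 proof holes `farm/logs/j3v13b-below-2.log`; `#print axioms` 3 ∕ 3 ⊆ {propext, Classical.choice, Quot.sound} `farm/logs/j3v13b-below-axioms.log`; placeholder-token grep 0; NAME LIST: `HodgeCM.Model.subset_span_of_liuDictionary_le` · `HodgeCM.Model.hThetaUnion_of_liuDictionary_le` · `HodgeCM.Model.hsmall_of_liuDictionary_le`) (`HOME/mc/pub-hodgecm-mc-axioms-1-g15/stage63/HodgeCM/Model/LiuDictionaryBelow.lean`, md5 889214948dea, 121 lines);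
landed by the gen-26 packager (p-g26) in gate run 63 as `HodgeCM/Model/LiuDictionaryBelow.lean` (verbatim).
-/
/-
Copyright (c) 2026 the pub-hodgecm formalisation cell (harness21).  New file, not vendored.
Origin: session planner-pub-hodgecm-mc-axioms-1-g15-0 (unit pub-hodgecm-mc-axioms-1-g15, CONSTRUCTION PROVER gen 15 of mc-axioms-1;
node N-i1 (L-lvl)), 2026-08-20.  (J3) AMENDMENT 5: the junction and its two E-shaped corollaries with the geometric input `hIso`
asked only BELOW SOME LEVEL `Γ₁` — additive over the landed `Model/LiuDictionary` (RUN 62), nothing replaced.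
-/
import Summits.HodgeConjecture.HodgeCM.Model.LiuDictionary

/-!
# (J3) — the junction below a level

`Model/LiuDictionary` (RUN 62) proves `subset_span_of_liuDictionary` with the (J2)+(J4) input

  `hIso : ∀ Γ, ∀ ω ∈ Θ Γ, ∃ x : T.H, x ∈ fixedBy Γ.K T.H ∧ T.res Γ x = ω ∧ x ∈ ⨆ μ ∈ S, T.block μ`

over ALL levels `Γ`.  The CONSTRUCTED restriction `res Γ` of the tower instance (binder-1-g16 #R111 `resTotal`, #R113
`LiuDictionary.ofTower`) is the identity-component restriction only at levels below a conjugate of `K_f(3)` (where the components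
`P_{Γ.conj h}` are torsion-free quotients) and the zero map elsewhere, so an instance can supply `hIso` only below some level; since
the junction's conclusion `∃ Γ₀, ∀ Γ ≤ Γ₀, …` only ever descends, nothing is lost by asking `hIso` below a level `Γ₁`:

* `subset_span_of_liuDictionary_le` — the junction with `hIso : ∃ Γ₁, ∀ Γ ≤ Γ₁, ∀ ω ∈ Θ Γ, ∃ x, …` (from the landed junction run on
  the family emptied above `Γ₁`; threshold `Γ₀ ⊓ Γ₁`);
* `hThetaUnion_of_liuDictionary_le`, `hsmall_of_liuDictionary_le` — the E-shaped corollaries of `Model/LiuDictionary` with the last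
  clause of `hJ` weakened the same way; conclusions VERBATIM those of `hThetaUnion_of_liuDictionary` / `hsmall_of_liuDictionary`
  (= the hypothesis `hΘ` of `Model.hsmall_of_commonReflexUnion_of … P`, resp. E's scoped `hsmall`).

At the tower instance `Γ₁ := Level.three V` (binder-1 `Level.belowConjThree_of_le_three`, #R115 `subset_span_of_tower`).
KERNEL throughout; records: none beyond those of the imported leaf. [folklore]
-/

noncomputable section

open Function Set
open NumberField
open Literature.AlgebraicGeometry.Motives
open Literature.AlgebraicGeometry.ShimuraVarieties
open Literature.AlgebraicGeometry.HodgeTheory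
open Literature.NumberTheory.Automorphic
open Literature.NumberTheory.Automorphic.PicardCM

namespace HodgeCM.Model

open HodgeCM.Literature.Theta
open HodgeCM.CMTypeOps (inflate)

variable {hHD : exists_isReal_hodgeModel} {hI : hodgePQ_independent_of_hodgeModel}
  {h₁ : BallQuotientUniformised} {h₃ : CMAbelianVarietyRealised}
variable {L : CMField} {ι₁ : L →+* ℂ} {V : HermSpace3 L ι₁}

/-- **The junction below a level.**  As `subset_span_of_liuDictionary`, with the (J2)+(J4) input `hIso` asked only for `Γ ≤ Γ₁`
for some level `Γ₁`; the threshold becomes `Γ₀ ⊓ Γ₁`. [folklore] -/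
theorem subset_span_of_liuDictionary_le (T : LiuDictionary hHD hI h₁ h₃ V)
    (hirr : T.Irreducible) (h413 : T.Prop413) (h4182 : T.Thm418_2) (hμ : T.MuSeparated) (h418 : T.Thm418C)
    {K : CMField} {Ψ : CMType K} {σ : K →+* ℂ}
    (S : Finset T.Char) (hΦ : ∀ μ ∈ S, T.PhiMu μ)
    (hcorner : ∀ μ ∈ S, ∀ d : LiuCMSide, T.adm μ d → d.IsCorner K Ψ σ)
    (Θ : ∀ Γ : Level V, Set ((picardCMUniverse hHD hI h₁ h₃).CohC ((picardCMUniverse hHD hI h₁ h₃).pms L ι₁ V Γ) 1))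
    (hIso : ∃ Γ₁ : Level V, ∀ Γ ≤ Γ₁, ∀ ω ∈ Θ Γ,
      ∃ x : T.H, x ∈ fixedBy Γ.K T.H ∧ T.res Γ x = ω ∧ x ∈ ⨆ μ ∈ S, T.block μ) :
    ∃ Γ₀ : Level V, ∀ Γ ≤ Γ₀,
      Θ Γ ⊆ Submodule.span ℂ (⋃ D : CommonReflexInput K Ψ σ, D.surfaceClasses hHD hI h₁ h₃ V Γ) := by
  classical
  obtain ⟨Γ₁, hIso⟩ := hIso
  -- run the landed junction on the family emptied above `Γ₁`
  obtain ⟨Γ₀, hΓ₀⟩ := subset_span_of_liuDictionary T hirr h413 h4182 hμ h418 S hΦ hcorner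
    (fun Γ => if Γ ≤ Γ₁ then Θ Γ else ∅) (fun Γ ω hω => by
      by_cases h : Γ ≤ Γ₁
      · rw [if_pos h] at hω
        exact hIso Γ h ω hω
      · rw [if_neg h] at hω
        exact ((Set.mem_empty_iff_false ω).mp hω).elim)
  refine ⟨Γ₀ ⊓ Γ₁, fun Γ hΓ ω hω => ?_⟩
  have h := hΓ₀ Γ (hΓ.trans inf_le_left)
  rw [if_pos (hΓ.trans inf_le_right)] at h
  exact h hω

/-- **E-SHAPED COROLLARY (`hΘ∪` form), `hIso` below a level.**  As `hThetaUnion_of_liuDictionary` with the last clause of `hJ`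
weakened to `∃ Γ₁, ∀ Γ ≤ Γ₁, …`; the conclusion is the hypothesis `hΘ` of `Model.hsmall_of_commonReflexUnion_of … P` VERBATIM. [folklore] -/
theorem hThetaUnion_of_liuDictionary_le (R : (picardCMUniverse hHD hI h₁ h₃).ThetaModel)
    (T : ∀ {L : CMField} {ι₁ : L →+* ℂ} (V : HermSpace3 L ι₁), LiuDictionary hHD hI h₁ h₃ V)
    (hcite : ∀ {L : CMField} {ι₁ : L →+* ℂ} (V : HermSpace3 L ι₁),
      (T V).Irreducible ∧ (T V).Prop413 ∧ (T V).Thm418_2 ∧ (T V).MuSeparated ∧ (T V).Thm418C)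
    (P : ∀ {L : CMField} {ι₁ : L →+* ℂ}, HermSpace3 L ι₁ → SeesawCtx L → Prop)
    (hJ : ∀ {L : CMField} {ι₁ : L →+* ℂ} (V : HermSpace3 L ι₁) (c : SeesawCtx L), P V c → R.GoodCtx ι₁ c →
      Module.finrank ℚ c.K = 6 → ∀ i : Fin 4, ∃ S : Finset (T V).Char,
        (∀ μ ∈ S, (T V).PhiMu μ) ∧
        (∀ μ ∈ S, ∀ d : LiuCMSide, (T V).adm μ d → d.IsCorner c.K (c.Ψ i) c.σ) ∧
        ∃ Γ₁ : Level V, ∀ Γ ≤ Γ₁, ∀ ω ∈ R.Theta V c i Γ, ∃ x : (T V).H,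
          x ∈ fixedBy Γ.K (T V).H ∧ (T V).res Γ x = ω ∧ x ∈ ⨆ μ ∈ S, (T V).block μ) :
    ∀ {L : CMField} {ι₁ : L →+* ℂ} (V : HermSpace3 L ι₁) (c : SeesawCtx L), P V c → R.GoodCtx ι₁ c →
      Module.finrank ℚ c.K = 6 → ∀ i : Fin 4, ∃ Γ₀ : Level V, ∀ Γ ≤ Γ₀,
        R.Theta V c i Γ ⊆
          Submodule.span ℂ (⋃ D : CommonReflexInput c.K (c.Ψ i) c.σ, D.surfaceClasses hHD hI h₁ h₃ V Γ) := by
  intro L ι₁ V c hP hgood h6 i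
  obtain ⟨S, hΦ, hcorner, hIso⟩ := hJ V c hP hgood h6 i
  obtain ⟨hirr, h413, h4182, hμ, h418⟩ := hcite V
  exact subset_span_of_liuDictionary_le (T V) hirr h413 h4182 hμ h418 S hΦ hcorner (fun Γ => R.Theta V c i Γ) hIso

/-- **… whence E's `hsmall` (scoped by `P`), `hIso` below a level**, by binder-1's landed `hsmall_of_commonReflexUnion_of`
(Riemann's fullness `hR`); conclusion VERBATIM that of `hsmall_of_liuDictionary`. [folklore] -/
theorem hsmall_of_liuDictionary_le (hR : DeligneMilne1982_Thm_6_20_full)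
    (R : (picardCMUniverse hHD hI h₁ h₃).ThetaModel)
    (T : ∀ {L : CMField} {ι₁ : L →+* ℂ} (V : HermSpace3 L ι₁), LiuDictionary hHD hI h₁ h₃ V)
    (hcite : ∀ {L : CMField} {ι₁ : L →+* ℂ} (V : HermSpace3 L ι₁),
      (T V).Irreducible ∧ (T V).Prop413 ∧ (T V).Thm418_2 ∧ (T V).MuSeparated ∧ (T V).Thm418C)
    (P : ∀ {L : CMField} {ι₁ : L →+* ℂ}, HermSpace3 L ι₁ → SeesawCtx L → Prop)
    (hJ : ∀ {L : CMField} {ι₁ : L →+* ℂ} (V : HermSpace3 L ι₁) (c : SeesawCtx L), P V c → R.GoodCtx ι₁ c →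
      Module.finrank ℚ c.K = 6 → ∀ i : Fin 4, ∃ S : Finset (T V).Char,
        (∀ μ ∈ S, (T V).PhiMu μ) ∧
        (∀ μ ∈ S, ∀ d : LiuCMSide, (T V).adm μ d → d.IsCorner c.K (c.Ψ i) c.σ) ∧
        ∃ Γ₁ : Level V, ∀ Γ ≤ Γ₁, ∀ ω ∈ R.Theta V c i Γ, ∃ x : (T V).H,
          x ∈ fixedBy Γ.K (T V).H ∧ (T V).res Γ x = ω ∧ x ∈ ⨆ μ ∈ S, (T V).block μ) :
    ∀ {L : CMField} {ι₁ : L →+* ℂ} (V : HermSpace3 L ι₁) (c : SeesawCtx L), P V c → R.GoodCtx ι₁ c →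
      Module.finrank ℚ c.K = 6 → ∀ i : Fin 4, ∃ Γ₀ : Level V, ∀ Γ ≤ Γ₀,
        ∃ (M : CMField) (k : c.K →+* M) (σ' : M →+* ℂ), σ'.comp k = c.σ ∧
          R.Theta V c i Γ ⊆ (picardCMUniverse hHD hI h₁ h₃).Uiso Γ M (inflate k (c.Ψ i)) σ' :=
  hsmall_of_commonReflexUnion_of hHD hI h₁ h₃ hR R P (hThetaUnion_of_liuDictionary_le R T hcite P hJ)

end HodgeCM.Model

end
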